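import Mathlib
import Literature.Analysis.FluidPDE.SelfSimilarEulerProfile
import HarnessLib

/-!
# Crux `EulerZoomLiouville.PowerGaugeEulerLiouville` (stmt-NavierStokesRegularity-19832), line `relative_equilibria` (ns-idea-11), R2 / R2-ESC:
# THE SPIRAL BERNOULLI DEFECT LAW — `W_S·∇ℋ_S = (2γ−1)(|W_S|² − ⟪W_S, Sy⟫)` (kernel certificate of evidence #51, LEAD 19832 g17 key 15:03:11Z)

Route №10 `EulerZoomLiouville` (NavierStokesRegularity), crux E; width seat ns-sfl-p1 g11 (R2-ESC box).  For the CLASSICAL SPIRAL PROFILE SYSTEM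
`(1−γ)V − SV + (W_S·∇)V + ∇P = 0`, `W_S = V + γy + Sy`, `S` skew (`⟪Sx, y⟫ = −⟪x, Sy⟫`) — Perelman's rotated self-similar ansatz inserted
in Euler (`IsSpiralProfile γ S V P` of `Cruxes/…/Lines/relative_equilibria.lean`, pointwise clause; `S = 0` is CIV (3.3)) — the untwisted
Bernoulli function (CIV (3.30)) corrected by the centrifugal term,
`ℋ_S(y) = ½|W_S(y)|² + P(y) + ½γ(γ−1)|y|² − ½|Sy|²` (`= P + V·W_S − ½|V|² − ½γ(1−2γ)|y|²`, the LEAD's form), satisfies POINTWISE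
**`Dℋ_S(y)[W_S(y)] = (2γ−1)(|W_S(y)|² − ⟪W_S(y), Sy⟫)`** — the untwisted transport identity `V·∇ℋ = (2γ−1)|V|²`
(`IsSelfSimilarEulerProfile.fderiv_selfSimilarBernoulli_transport`, CIV (3.31)) plus the DEFECT `−(2γ−1)⟪W_S, Sy⟫`, the work of the frame
rotation against the scaling drift.  Along a backward half-orbit `Y' = −W_S(Y)` the defect is `(1−2γ)⟪Y', SY⟫`, i.e. `(1−2γ)|s|` times the
areal velocity about the spin axis: ℋ_S is NOT a Lyapunov function for `S ≠ 0`, and exactly this is the obstruction isolated in evidence #51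
(R2-ESC-OBSTRUCTION.md) to porting `Loc.volume_vortical_confined_eq_zero` to the spiral stratum.

* `Spiral.fderiv_spiralBernoulli_wind` — the pointwise defect law (hypotheses at ONE point: `V`, `P` differentiable there, the spiral equation there);
* `Spiral.spiralBernoulli_comp_sub_eq_of_Ici` — the integrated law along a half-orbit `Y' = σ W_S(Y)` on `[0,∞)`:
  `ℋ_S(Y b) − ℋ_S(Y a) = σ(2γ−1) ∫_a^b (|W_S(Y)|² − ⟪W_S(Y), S(Y)⟫)` (`0 ≤ a ≤ b`), the twin of `bernoulli_comp_sub_eq_of_Ici`.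

WHAT THIS IS NOT: not NS, not E, not a stub and not a member: a class-free calculus certificate for the R2-ESC obstruction memo of a width sub-line
(spiral = `O(3)`-twisted self-similar stratum); 19832 OPEN; no summit statement is proved by this file.
[folklore; ConstantinIgnatovaVicol2026Putative §3.4.3 eq. (3.29)–(3.31) (untwisted); ChaeTsai2013DSS p. 4 (Perelman's rotated ansatz)]
-/

noncomputable section

-- flat `Theorems/<Route><Decl>…` files of one crux share the namespace of the crux (tree convention: `Summit.<S>.<S>.…`)
set_option linter.dupNamespace false

open MeasureTheory Set Filter Topology Metric Function
open scoped RealInnerProductSpace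

namespace Summit.NavierStokesRegularity.NavierStokesRegularity.Theorems.PowerGaugeEulerLiouville

open Literature.Analysis Literature.Analysis.FluidPDE

namespace Spiral

variable {S : EuclideanSpace ℝ (Fin 3) →L[ℝ] EuclideanSpace ℝ (Fin 3)}

/-- ★ **THE SPIRAL BERNOULLI DEFECT LAW (pointwise).**  Let `S` be skew, `V` and `P` differentiable at `y`, and let the spiral profile
equation hold at `y`: `(1−γ)V(y) − S V(y) + DV(y)[W] + ∇P(y) = 0` with `W = V(y) + γy + Sy`.  Then for
`ℋ_S = ½|V + γ· + S·|² + P + ½γ(γ−1)|·|² − ½|S·|²`:  `Dℋ_S(y)[W] = (2γ−1)(|W|² − ⟪W, Sy⟫)`.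
Proof = CIV (3.31) verbatim (`Dℋ_S[W] = ⟪W, DV[W] + γW + SW⟫ + DP[W] + γ(γ−1)⟪y, W⟫ − ⟪Sy, SW⟫`, the equation dotted with `W`,
`V = W − γy − Sy`) plus skewness: `⟪W, SW⟫ = 0`, `⟪W, S²y⟫ = −⟪SW, Sy⟫`. `S = 0`: `fderiv_selfSimilarBernoulli_transport`. [folklore] -/
theorem fderiv_spiralBernoulli_wind {γ : ℝ} (hS : ∀ x y : EuclideanSpace ℝ (Fin 3), ⟪S x, y⟫ = -⟪x, S y⟫)
    {V : EuclideanSpace ℝ (Fin 3) → EuclideanSpace ℝ (Fin 3)} {P : EuclideanSpace ℝ (Fin 3) → ℝ} {y : EuclideanSpace ℝ (Fin 3)}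
    (hV : DifferentiableAt ℝ V y) (hP : DifferentiableAt ℝ P y)
    (heq : (1 - γ) • V y - S (V y) + fderiv ℝ V y (V y + γ • y + S y) + gradient P y = 0) :
    fderiv ℝ (fun z => (1 / 2 : ℝ) * ‖V z + γ • z + S z‖ ^ 2 + P z + γ * (γ - 1) / 2 * ‖z‖ ^ 2 - (1 / 2 : ℝ) * ‖S z‖ ^ 2) y
        (V y + γ • y + S y) =
      (2 * γ - 1) * (‖V y + γ • y + S y‖ ^ 2 - ⟪V y + γ • y + S y, S y⟫) := by
  -- adapted from `IsSelfSimilarEulerProfile.fderiv_selfSimilarBernoulli_transport` (Literature/Analysis/FluidPDE/SelfSimilarEulerProfile)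
  set W : EuclideanSpace ℝ (Fin 3) := V y + γ • y + S y with hW
  -- derivatives of the four summands of `ℋ_S`
  have hVd : HasFDerivAt V (fderiv ℝ V y) y := hV.hasFDerivAt
  have hSd : HasFDerivAt (fun z : EuclideanSpace ℝ (Fin 3) => S z) S y := S.hasFDerivAt
  have hWd : HasFDerivAt (fun z => V z + γ • z + S z)
      (fderiv ℝ V y + γ • ContinuousLinearMap.id ℝ (EuclideanSpace ℝ (Fin 3)) + S) y :=
    (hVd.fun_add ((hasFDerivAt_id y).fun_const_smul γ)).fun_add hSd
  have hPd : HasFDerivAt P (fderiv ℝ P y) y := hP.hasFDerivAt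
  have hsq := (hasFDerivAt_id y).norm_sq
  have e := (((hWd.norm_sq.const_mul (1 / 2 : ℝ)).fun_add hPd).fun_add (hsq.const_mul (γ * (γ - 1) / 2))).fun_sub
    (hSd.norm_sq.const_mul (1 / 2 : ℝ))
  have hH : HasFDerivAt (fun z => (1 / 2 : ℝ) * ‖V z + γ • z + S z‖ ^ 2 + P z + γ * (γ - 1) / 2 * ‖z‖ ^ 2 -
      (1 / 2 : ℝ) * ‖S z‖ ^ 2) _ y :=
    e.congr_of_eventuallyEq (Filter.Eventually.of_forall fun z => rfl)
  rw [hH.fderiv]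
  -- the spiral equation dotted with `W`
  have key : ⟪W, fderiv ℝ V y W⟫ = -((1 - γ) * ⟪W, V y⟫) + ⟪W, S (V y)⟫ - fderiv ℝ P y W := by
    have e2 := congrArg (fun z => ⟪W, z⟫) heq
    simp only [inner_add_right, inner_sub_right, inner_smul_right, inner_zero_right] at e2
    rw [real_inner_comm (gradient P y), inner_gradient_left] at e2
    linarith
  -- skewness bookkeeping
  have hskew1 : ⟪W, S W⟫ = 0 := by
    have h := hS W W
    rw [← real_inner_comm (S W) W] at h
    linarith
  have hVW : V y = W - γ • y - S y := by rw [hW]; abel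
  have h5 : ⟪W, V y⟫ = ‖W‖ ^ 2 - γ * ⟪W, y⟫ - ⟪W, S y⟫ := by
    rw [hVW, inner_sub_right, inner_sub_right, inner_smul_right, real_inner_self_eq_norm_sq]
  have h6 : ⟪W, S (V y)⟫ = -(γ * ⟪W, S y⟫) + ⟪S W, S y⟫ := by
    rw [hVW, map_sub, map_sub, map_smul, inner_sub_right, inner_sub_right, inner_smul_right, hskew1]
    have h := hS W (S y)
    linarith
  have h7 : ⟪y, W⟫ = ⟪W, y⟫ := real_inner_comm _ _
  have h8 : ⟪S y, S W⟫ = ⟪S W, S y⟫ := real_inner_comm _ _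
  -- evaluate the derivative at `W`
  have hmain : ⟪W, fderiv ℝ V y W + γ • W + S W⟫ = ⟪W, fderiv ℝ V y W⟫ + γ * ‖W‖ ^ 2 + ⟪W, S W⟫ := by
    rw [inner_add_right, inner_add_right, inner_smul_right, real_inner_self_eq_norm_sq]
  simp only [_root_.sub_apply, _root_.add_apply, _root_.smul_apply, two_nsmul, ContinuousLinearMap.comp_apply,
    ContinuousLinearMap.id_apply, innerSL_apply_apply, smul_eq_mul, id_eq]
  rw [← hW]
  linear_combination hmain + key + (γ - 1) * h5 + h6 + γ * (γ - 1) * h7 - h8 + (1 : ℝ) * hskew1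

/-- **THE INTEGRATED DEFECT LAW ALONG A HALF-ORBIT** (`0 ≤ a ≤ b`; ODE on `[0,∞)` only, as in `bernoulli_comp_sub_eq_of_Ici`): for a `C¹` pair
`(V, P)` solving the spiral system everywhere (`S` skew) and a continuous curve with `Y' = σ W_S(Y)` on `[0, ∞)`,
`ℋ_S(Y b) − ℋ_S(Y a) = σ(2γ−1) ∫_a^b (|W_S(Y t)|² − ⟪W_S(Y t), S(Y t)⟫) dt`.  For `σ = −1` (backward orbits) the second term is
`(1−2γ)∫⟪Y', SY⟫` = `(1−2γ)|s| ×` (area swept about the spin axis): the obstruction of evidence #51 in closed form. [folklore] -/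
theorem spiralBernoulli_comp_sub_eq_of_Ici {γ σ : ℝ} (hS : ∀ x y : EuclideanSpace ℝ (Fin 3), ⟪S x, y⟫ = -⟪x, S y⟫)
    {V : EuclideanSpace ℝ (Fin 3) → EuclideanSpace ℝ (Fin 3)} {P : EuclideanSpace ℝ (Fin 3) → ℝ}
    (hV : ContDiff ℝ 1 V) (hP : ContDiff ℝ 1 P)
    (heq : ∀ y : EuclideanSpace ℝ (Fin 3), (1 - γ) • V y - S (V y) + fderiv ℝ V y (V y + γ • y + S y) + gradient P y = 0)
    {Y : ℝ → EuclideanSpace ℝ (Fin 3)} (hYc : Continuous Y)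
    (hY : ∀ t, 0 ≤ t → HasDerivAt Y (σ • (V (Y t) + γ • Y t + S (Y t))) t)
    {a b : ℝ} (ha : 0 ≤ a) (hab : a ≤ b) :
    ((1 / 2 : ℝ) * ‖V (Y b) + γ • Y b + S (Y b)‖ ^ 2 + P (Y b) + γ * (γ - 1) / 2 * ‖Y b‖ ^ 2 - (1 / 2 : ℝ) * ‖S (Y b)‖ ^ 2) -
      ((1 / 2 : ℝ) * ‖V (Y a) + γ • Y a + S (Y a)‖ ^ 2 + P (Y a) + γ * (γ - 1) / 2 * ‖Y a‖ ^ 2 - (1 / 2 : ℝ) * ‖S (Y a)‖ ^ 2) =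
      σ * (2 * γ - 1) * ∫ t in a..b, (‖V (Y t) + γ • Y t + S (Y t)‖ ^ 2 - ⟪V (Y t) + γ • Y t + S (Y t), S (Y t)⟫) := by
  -- adapted from `bernoulli_comp_sub_eq_of_Ici` (…SelfSimilarHalfOrbitKit)
  set H : EuclideanSpace ℝ (Fin 3) → ℝ := fun z => (1 / 2 : ℝ) * ‖V z + γ • z + S z‖ ^ 2 + P z + γ * (γ - 1) / 2 * ‖z‖ ^ 2 -
    (1 / 2 : ℝ) * ‖S z‖ ^ 2 with hHdef
  have hVd : Differentiable ℝ V := hV.differentiable one_ne_zero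
  have hPd : Differentiable ℝ P := hP.differentiable one_ne_zero
  have hWc : Continuous fun z : EuclideanSpace ℝ (Fin 3) => V z + γ • z + S z :=
    (hV.continuous.add (continuous_id.const_smul γ)).add S.continuous
  have hHd : Differentiable ℝ H := by
    refine (((((hVd.add (differentiable_id.const_smul γ)).add S.differentiable).norm_sq ℝ).const_mul _).add hPd).add
      ((differentiable_id.norm_sq ℝ).const_mul _) |>.sub ((S.differentiable.norm_sq ℝ).const_mul _)
  have hgc : Continuous fun t => σ * ((2 * γ - 1) *
      (‖V (Y t) + γ • Y t + S (Y t)‖ ^ 2 - ⟪V (Y t) + γ • Y t + S (Y t), S (Y t)⟫)) :=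
    continuous_const.mul (continuous_const.mul (((hWc.comp hYc).norm.pow 2).sub
      ((hWc.comp hYc).inner (S.continuous.comp hYc))))
  have hder : ∀ t ∈ uIcc a b, HasDerivAt (fun s => H (Y s))
      (σ * ((2 * γ - 1) * (‖V (Y t) + γ • Y t + S (Y t)‖ ^ 2 - ⟪V (Y t) + γ • Y t + S (Y t), S (Y t)⟫))) t := by
    intro t ht
    rw [uIcc_of_le hab] at ht
    have h1 : HasDerivAt (fun s => H (Y s)) (fderiv ℝ H (Y t) (σ • (V (Y t) + γ • Y t + S (Y t)))) t :=
      (hHd (Y t)).hasFDerivAt.comp_hasDerivAt t (hY t (ha.trans ht.1))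
    rw [map_smul, hHdef, fderiv_spiralBernoulli_wind hS (hVd (Y t)) (hPd (Y t)) (heq (Y t)), smul_eq_mul] at h1
    exact h1
  have key := intervalIntegral.integral_eq_sub_of_hasDerivAt hder (hgc.intervalIntegrable a b)
  simp only [hHdef] at key
  rw [← key, intervalIntegral.integral_const_mul, intervalIntegral.integral_const_mul, mul_assoc]

end Spiral

end Summit.NavierStokesRegularity.NavierStokesRegularity.Theorems.PowerGaugeEulerLiouville

end
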